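import Mathlib
import HarnessLib.Audit
import Summits.PneNP.PneNP.Theorems.PstarCrossCasePEq
import Summits.PneNP.PneNP.Theorems.PstarNorUnitMixed
import Summits.PneNP.PneNP.Theorems.PstarNorUnitDirAssembly

/-!
# The blind free CROSS gate, regime P (node N2): the real chords are ONE unit, or all (NOR) (O2 / E1; prover-1 g23)

FRONTIER range-avoidance ladder, rung F-N3 (`stmt-PneNP-19007`), cell `pnp-ideate`; restricted-model proof complexity — nothing here bears on `P` versus `NP`.

Node N2 (`PstarCrossNodes.CrossCasePChords`): regime P, `q := q_{(1,0)}` (polar form `polarDir (1,0) = freePolar₂`), real chords `E = (N.erase e_q).erase e_p`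
each (EQ)/(EXC)/(NOR) w.r.t. `q` (`PstarCrossCaseP.forced_cases_real`).  The (EQ) row is closed (`PstarCrossCasePEq.crossCaseP_eq`).  The CLEAN theory's
model-free lemmas finish the sorting:

* `caseP_unit_of_exc` — an (EXC) chord is a UNIT w.r.t. `q` (`PstarNorUnitExcCore.exc_unit_core`: `D e = {j₁, j₂}` with disjoint AND pairs, literals
  `σ ∈ j₁`, `τ ∈ j₂` carrying the linear parts, the polar formula `polarDir (1,0) (e_v,e_w) = [v ~ w in D e] + [{v,w} = {σ,τ}]`, a gadget with AND pair
  `{σ,τ}`), unless `#J₀ ≤ 5`;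
* `caseP_nor_form` — a (NOR) chord puts `q` in NOR form `q = (polarDir x b + β)(polarDir x a + α) + 1`;
* `caseP_unit_unique` — two units are the same chord (`PstarNorUnitMixed.D_eq_of_excUnits`, `PstarChordBridgeFundamental.eq_of_fundamental_eq`);
  `caseP_nor_excludes` — in NOR form no chord is (EQ) (`PstarNorUnitDirAssembly.not_EQ_of_nor_dir`) or a unit (`PstarNorUnitMixed.false_of_nor_of_excUnit`);
(The unit and NOR-form predicates are spelled out inline.)
* **`caseP_dichotomy`** — hence: `#J₀ ≤ 5`, OR `E = {e}` is a single UNIT chord, OR `q` is in NOR form and EVERY real chord is (NOR) (carries the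
  `(λ₁+1)m₁ + (λ₂+1)m₂` data of `forced_cases_real`).  These two are what remains of N2.
-/

set_option linter.dupNamespace false -- `Summit.PneNP.PneNP.…`: summit = sub-problem name (D-0017 single-conjunct layout)

open Finset Module Literature.Computability.Complexity
open Summit.PneNP.PneNP.Theorems.PstarTyped (Typed)
open Summit.PneNP.PneNP.Theorems.PstarSALevel (BoundaryExpanding SimpleOverlap)
open Summit.PneNP.PneNP.Theorems.PstarGapLinearised (andPair)
open Summit.PneNP.PneNP.Theorems.PstarCubeIdeals (IsAffineFn)
open Summit.PneNP.PneNP.Theorems.PstarProductRank (qform polar)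
open Summit.PneNP.PneNP.Theorems.PstarPathRank (AndAdj)
open Summit.PneNP.PneNP.Theorems.PstarReadSumset (V2)
open Summit.PneNP.PneNP.Theorems.PstarChordSystem (ChordSystem)
open Summit.PneNP.PneNP.Theorems.PstarChordBridge
open Summit.PneNP.PneNP.Theorems.PstarChordBridgeForcing (freeMon freePolar gam sys_u_eq)
open Summit.PneNP.PneNP.Theorems.PstarChordBridgeFundamental (eq_of_fundamental_eq)
open Summit.PneNP.PneNP.Theorems.PstarChordBridgeBasis (qDir polarDir)
open Summit.PneNP.PneNP.Theorems.PstarChordBridgeCorner (qDir_add)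
open Summit.PneNP.PneNP.Theorems.PstarCrossData (CrossData)
open Summit.PneNP.PneNP.Theorems.PstarCrossSystem
open Summit.PneNP.PneNP.Theorems.PstarCrossCaseP (qDir10_eq u_of_q forced_cases_real)
open Summit.PneNP.PneNP.Theorems.PstarCrossCasePEq (crossCaseP_eq)
open Summit.PneNP.PneNP.Theorems.PstarNorUnitExcCore (exc_unit_core)
open Summit.PneNP.PneNP.Theorems.PstarNorUnitMixed (D_eq_of_excUnits false_of_nor_of_excUnit)
open Summit.PneNP.PneNP.Theorems.PstarNorUnitDirAssembly (not_EQ_of_nor_dir)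

namespace Summit.PneNP.PneNP.Theorems.PstarCrossCasePStructure

variable {n m : ℕ}

section

variable (I : LocalMap 4 n m) {r : ℕ} {B : BridgeData n m} {e_p e_q g₀ : Fin m}

/-- `polarDir (1,0)` is the second constraint's free polar form. -/
theorem polarDir_one_zero (B : BridgeData n m) : polarDir I B (1, 0) = freePolar I B.N B.T₂ B.G₂ := by
  unfold PstarChordBridgeBasis.polarDir
  rw [zero_smul, one_smul, zero_add]

/-- `F₂ + t₂ = q_{(1,0)}`. -/
theorem snd_eq_qDir (B : BridgeData n m) (e_p e_q : Fin m) (x : Fin n → ZMod 2) : ((sys I B).F x).2 + (sys I B).t.2 = qDir I B (1, 0) x := by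
  rw [qDir10_eq I B e_p e_q]; rfl

/-- **An (EXC) chord of regime P is a unit, unless `#J₀ ≤ 5`.** -/
theorem caseP_unit_of_exc (hI : I.IsPure xorAndPred) (hT : Typed I) (hS : SimpleOverlap I) (hB : BoundaryExpanding r I)
    (hD : CrossData I r B e_p e_q g₀) (hSR : ((sys I B).vsys e_p e_q).SingleRead) {e : Fin m} (he : e ∈ (B.N.erase e_q).erase e_p)
    {ν₁ ν₂ : (Fin n → ZMod 2) → ZMod 2} (hν₁ : IsAffineFn ν₁) (hν₂ : IsAffineFn ν₂) {κ : ZMod 2}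
    (hEXC : ∀ x, qform (B.D e) (fun j => I.vars j 2) (fun j => I.vars j 3) x = (((sys I B).F x).2 + (sys I B).t.2) + ν₁ x * ν₂ x + κ) :
    B.J₀.card ≤ 5 ∨ (∃ ν₁ ν₂ : (Fin n → ZMod 2) → ZMod 2, IsAffineFn ν₁ ∧ IsAffineFn ν₂ ∧
      (∃ κ : ZMod 2, ∀ x, qform (B.D e) (fun j => I.vars j 2) (fun j => I.vars j 3) x = qDir I B (1, 0) x + ν₁ x * ν₂ x + κ) ∧
      ∃ j₁ j₂ : Fin m, ∃ σ τ : Fin n, j₁ ≠ j₂ ∧ B.D e = {j₁, j₂} ∧ Disjoint (andPair I j₁) (andPair I j₂) ∧ σ ∈ andPair I j₁ ∧ τ ∈ andPair I j₂ ∧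
      (∀ v : Fin n, (ν₁ (Pi.single v 1) ≠ ν₁ 0 ∨ ν₂ (Pi.single v 1) ≠ ν₂ 0) ↔ (v = σ ∨ v = τ)) ∧
      ∀ v w : Fin n, polarDir I B (1, 0) (Pi.single v 1) (Pi.single w 1) =
        (if AndAdj I (B.D e) v w then 1 else 0) + (if (v = σ ∧ w = τ) ∨ (v = τ ∧ w = σ) then 1 else 0)) := by
  have heq : e ∈ B.N.erase e_q := mem_of_mem_erase he
  have hne : e ≠ e_p := ne_of_mem_erase he
  have heN : e ∈ B.N := mem_of_mem_erase heq
  have heJ : e ∈ B.J₀ := hD.wf.hN heN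
  have hr : (B.J₀ ∪ B.G₁ ∪ B.G₂).card ≤ r := by
    refine le_trans (card_le_card ?_) hD.rad
    exact union_subset_union (union_subset_union subset_rfl (subset_insert g₀ B.G₁)) subset_rfl
  have hd₁ : Disjoint B.G₁ B.J₀ := Finset.disjoint_of_subset_left (subset_insert g₀ B.G₁) hD.disj₁
  have heG : e ∉ B.G₁ ∪ B.G₂ := by
    rw [mem_union, not_or]
    exact ⟨fun h => Finset.disjoint_left.1 hd₁ h heJ, fun h => Finset.disjoint_left.1 hD.disj₂ h heJ⟩
  have hZ : ∀ x, qDir I B (1, 0) x = 0 → qform (B.D e) (fun j => I.vars j 2) (fun j => I.vars j 3) x = 1 + gam B e := fun x hx => by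
    have h := u_of_q I hI hT hD hSR heq hne hx
    rw [sys_u_eq] at h
    have e1 : ∀ g Q : ZMod 2, g + Q = 1 → Q = 1 + g := by decide
    exact e1 _ _ h
  have hEXC' : ∀ x, qform (B.D e) (fun j => I.vars j 2) (fun j => I.vars j 3) x = qDir I B (1, 0) x + ν₁ x * ν₂ x + κ := fun x => by
    rw [hEXC x, snd_eq_qDir I B e_p e_q]
  rcases exc_unit_core I hI hS hB hD.wf hr heN heG (1, 0) (qDir_add I B (1, 0)) hZ hν₁ hν₂ hEXC' with ⟨κ', hEQ⟩ | ⟨j₁, j₂, σ, τ, hj, hDe, hdisj, hσ, hτ, hsupp, hpol, -⟩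
  · left
    refine crossCaseP_eq I hI hT hS hB hD hSR he ⟨κ', fun x => ?_⟩
    rw [hEQ x, snd_eq_qDir I B e_p e_q]
  · exact Or.inr ⟨ν₁, ν₂, hν₁, hν₂, ⟨κ, hEXC'⟩, j₁, j₂, σ, τ, hj, hDe, hdisj, hσ, hτ, hsupp, hpol⟩

/-- **A (NOR) chord of regime P puts `q_{(1,0)}` in NOR form.** -/
theorem caseP_nor_form (B : BridgeData n m) (e_p e_q : Fin m) {a b : Fin n → ZMod 2}
    (hq : ∀ x, ((sys I B).F x).2 + (sys I B).t.2 =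
      (freePolar I B.N B.T₂ B.G₂ x b + ((((sys I B).F b).2 + (sys I B).t.2) + (((sys I B).F 0).2 + (sys I B).t.2))) *
        (freePolar I B.N B.T₂ B.G₂ x a + ((((sys I B).F a).2 + (sys I B).t.2) + (((sys I B).F 0).2 + (sys I B).t.2))) + 1) :
    (∃ a b : Fin n → ZMod 2, ∃ β α : ZMod 2, ∀ x, qDir I B (1, 0) x = (polarDir I B (1, 0) x b + β) * (polarDir I B (1, 0) x a + α) + 1) := by
  refine ⟨a, b, (((sys I B).F b).2 + (sys I B).t.2) + (((sys I B).F 0).2 + (sys I B).t.2),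
    (((sys I B).F a).2 + (sys I B).t.2) + (((sys I B).F 0).2 + (sys I B).t.2), fun x => ?_⟩
  rw [← snd_eq_qDir I B e_p e_q, polarDir_one_zero]
  exact hq x

/-- **Two units are the same chord.** -/
theorem caseP_unit_unique (hI : I.IsPure xorAndPred) (hS : SimpleOverlap I) (hW : B.WF I) {e e' : Fin m} (he : e ∈ B.N) (he' : e' ∈ B.N)
    (hu : (∃ j₁ j₂ : Fin m, ∃ σ τ : Fin n, j₁ ≠ j₂ ∧ B.D e = {j₁, j₂} ∧ Disjoint (andPair I j₁) (andPair I j₂) ∧ σ ∈ andPair I j₁ ∧ τ ∈ andPair I j₂ ∧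
      ∀ v w : Fin n, polarDir I B (1, 0) (Pi.single v 1) (Pi.single w 1) =
        (if AndAdj I (B.D e) v w then 1 else 0) + (if (v = σ ∧ w = τ) ∨ (v = τ ∧ w = σ) then 1 else 0))) (hu' : (∃ j₁ j₂ : Fin m, ∃ σ τ : Fin n, j₁ ≠ j₂ ∧ B.D e' = {j₁, j₂} ∧ Disjoint (andPair I j₁) (andPair I j₂) ∧ σ ∈ andPair I j₁ ∧ τ ∈ andPair I j₂ ∧
      ∀ v w : Fin n, polarDir I B (1, 0) (Pi.single v 1) (Pi.single w 1) =
        (if AndAdj I (B.D e') v w then 1 else 0) + (if (v = σ ∧ w = τ) ∨ (v = τ ∧ w = σ) then 1 else 0))) : e = e' := by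
  obtain ⟨j₁, j₂, σ, τ, -, hDe, hdisj, hσ, hτ, hpol⟩ := hu
  obtain ⟨k₁, k₂, σ', τ', hk, hDe', hdisj', hσ', hτ', hpol'⟩ := hu'
  have hDD : B.D e' = B.D e := D_eq_of_excUnits I hI hS hDe hdisj hσ hτ hpol hk hDe' hdisj' hσ' hτ' hpol'
  have heD : e ∉ B.D e := fun h => (mem_sdiff.1 (hW.hD e he h)).2 he
  have he'D : e' ∉ B.D e := fun h => (mem_sdiff.1 (hW.hD e he h)).2 he'
  exact eq_of_fundamental_eq I hI hS heD he'D (hW.hDeven e he) (hDD ▸ hW.hDeven e' he')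

/-- **In NOR form no chord is (EQ) and no chord is a unit.** -/
theorem caseP_nor_excludes (hI : I.IsPure xorAndPred) (hS : SimpleOverlap I) (hB : BoundaryExpanding r I) (hD : CrossData I r B e_p e_q g₀)
    (hnor : (∃ a b : Fin n → ZMod 2, ∃ β α : ZMod 2, ∀ x, qDir I B (1, 0) x = (polarDir I B (1, 0) x b + β) * (polarDir I B (1, 0) x a + α) + 1)) {e : Fin m} (he : e ∈ B.N) :
    (¬ ∃ κ : ZMod 2, ∀ x, qform (B.D e) (fun j => I.vars j 2) (fun j => I.vars j 3) x = qDir I B (1, 0) x + κ) ∧ ¬ (∃ j₁ j₂ : Fin m, ∃ σ τ : Fin n, j₁ ≠ j₂ ∧ B.D e = {j₁, j₂} ∧ Disjoint (andPair I j₁) (andPair I j₂) ∧ σ ∈ andPair I j₁ ∧ τ ∈ andPair I j₂ ∧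
      ∀ v w : Fin n, polarDir I B (1, 0) (Pi.single v 1) (Pi.single w 1) =
        (if AndAdj I (B.D e) v w then 1 else 0) + (if (v = σ ∧ w = τ) ∨ (v = τ ∧ w = σ) then 1 else 0)) := by
  obtain ⟨a, b, β, α, hq⟩ := hnor
  have hJr : B.J₀.card ≤ r := le_trans (card_le_card (subset_union_left.trans subset_union_left)) hD.rad
  refine ⟨fun ⟨κ, hEQ⟩ => not_EQ_of_nor_dir I hI hS hB hD.wf hJr (1, 0) hq he hEQ, fun hu => ?_⟩
  obtain ⟨j₁, j₂, σ, τ, -, hDe, hdisj, hσ, hτ, hpol⟩ := hu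
  exact false_of_nor_of_excUnit I hI hDe hdisj hσ hτ hpol (ζ := 1) hq

/-- **The N2 dichotomy.**  In regime P with a real chord: `#J₀ ≤ 5`, or the real chords are a SINGLE unit, or `q_{(1,0)}` is in NOR form and every real
chord is (NOR) (it carries the `(λ₁+1)m₁ + (λ₂+1)m₂` data of `forced_cases_real`, whose first two alternatives are then excluded). -/
theorem caseP_dichotomy (hI : I.IsPure xorAndPred) (hT : Typed I) (hS : SimpleOverlap I) (hB : BoundaryExpanding r I)
    (hD : CrossData I r B e_p e_q g₀) (hSR : ((sys I B).vsys e_p e_q).SingleRead) :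
    B.J₀.card ≤ 5 ∨
    (∃ e, (B.N.erase e_q).erase e_p = {e} ∧ (∃ ν₁ ν₂ : (Fin n → ZMod 2) → ZMod 2, IsAffineFn ν₁ ∧ IsAffineFn ν₂ ∧
      (∃ κ : ZMod 2, ∀ x, qform (B.D e) (fun j => I.vars j 2) (fun j => I.vars j 3) x = qDir I B (1, 0) x + ν₁ x * ν₂ x + κ) ∧
      ∃ j₁ j₂ : Fin m, ∃ σ τ : Fin n, j₁ ≠ j₂ ∧ B.D e = {j₁, j₂} ∧ Disjoint (andPair I j₁) (andPair I j₂) ∧ σ ∈ andPair I j₁ ∧ τ ∈ andPair I j₂ ∧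
      (∀ v : Fin n, (ν₁ (Pi.single v 1) ≠ ν₁ 0 ∨ ν₂ (Pi.single v 1) ≠ ν₂ 0) ↔ (v = σ ∨ v = τ)) ∧
      ∀ v w : Fin n, polarDir I B (1, 0) (Pi.single v 1) (Pi.single w 1) =
        (if AndAdj I (B.D e) v w then 1 else 0) + (if (v = σ ∧ w = τ) ∨ (v = τ ∧ w = σ) then 1 else 0))) ∨
    ((∃ a b : Fin n → ZMod 2, ∃ β α : ZMod 2, ∀ x, qDir I B (1, 0) x = (polarDir I B (1, 0) x b + β) * (polarDir I B (1, 0) x a + α) + 1) ∧ ∀ e ∈ (B.N.erase e_q).erase e_p,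
      (¬ ∃ κ : ZMod 2, ∀ x, qform (B.D e) (fun j => I.vars j 2) (fun j => I.vars j 3) x = qDir I B (1, 0) x + κ) ∧ ¬ (∃ j₁ j₂ : Fin m, ∃ σ τ : Fin n, j₁ ≠ j₂ ∧ B.D e = {j₁, j₂} ∧ Disjoint (andPair I j₁) (andPair I j₂) ∧ σ ∈ andPair I j₁ ∧ τ ∈ andPair I j₂ ∧
      ∀ v w : Fin n, polarDir I B (1, 0) (Pi.single v 1) (Pi.single w 1) =
        (if AndAdj I (B.D e) v w then 1 else 0) + (if (v = σ ∧ w = τ) ∨ (v = τ ∧ w = σ) then 1 else 0))) ∨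
    (B.N.erase e_q).erase e_p = ∅ := by
  classical
  by_cases hE : (B.N.erase e_q).erase e_p = ∅
  · exact Or.inr (Or.inr (Or.inr hE))
  -- each real chord: `≤ 5`, unit, or NOR form
  have hsort : ∀ e ∈ (B.N.erase e_q).erase e_p, B.J₀.card ≤ 5 ∨ (∃ ν₁ ν₂ : (Fin n → ZMod 2) → ZMod 2, IsAffineFn ν₁ ∧ IsAffineFn ν₂ ∧
      (∃ κ : ZMod 2, ∀ x, qform (B.D e) (fun j => I.vars j 2) (fun j => I.vars j 3) x = qDir I B (1, 0) x + ν₁ x * ν₂ x + κ) ∧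
      ∃ j₁ j₂ : Fin m, ∃ σ τ : Fin n, j₁ ≠ j₂ ∧ B.D e = {j₁, j₂} ∧ Disjoint (andPair I j₁) (andPair I j₂) ∧ σ ∈ andPair I j₁ ∧ τ ∈ andPair I j₂ ∧
      (∀ v : Fin n, (ν₁ (Pi.single v 1) ≠ ν₁ 0 ∨ ν₂ (Pi.single v 1) ≠ ν₂ 0) ↔ (v = σ ∨ v = τ)) ∧
      ∀ v w : Fin n, polarDir I B (1, 0) (Pi.single v 1) (Pi.single w 1) =
        (if AndAdj I (B.D e) v w then 1 else 0) + (if (v = σ ∧ w = τ) ∨ (v = τ ∧ w = σ) then 1 else 0)) ∨ (∃ a b : Fin n → ZMod 2, ∃ β α : ZMod 2, ∀ x, qDir I B (1, 0) x = (polarDir I B (1, 0) x b + β) * (polarDir I B (1, 0) x a + α) + 1) := by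
    intro e he
    rcases forced_cases_real I hI hT hS hB hD hSR (mem_of_mem_erase he) (ne_of_mem_erase he) with hEQ | ⟨ν₁, ν₂, hν₁, hν₂, κ, hEXC⟩ | ⟨a, b, -, hq, -⟩
    · exact Or.inl (crossCaseP_eq I hI hT hS hB hD hSR he hEQ)
    · rcases caseP_unit_of_exc I hI hT hS hB hD hSR he hν₁ hν₂ hEXC with h | h
      · exact Or.inl h
      · exact Or.inr (Or.inl h)
    · exact Or.inr (Or.inr (caseP_nor_form I B e_p e_q hq))
  by_cases h5 : B.J₀.card ≤ 5
  · exact Or.inl h5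
  by_cases hnor : (∃ a b : Fin n → ZMod 2, ∃ β α : ZMod 2, ∀ x, qDir I B (1, 0) x = (polarDir I B (1, 0) x b + β) * (polarDir I B (1, 0) x a + α) + 1)
  · exact Or.inr (Or.inr (Or.inl ⟨hnor, fun e he => caseP_nor_excludes I hI hS hB hD hnor (mem_of_mem_erase (mem_of_mem_erase he))⟩))
  · -- every real chord is a unit, and units are unique
    right; left
    obtain ⟨e, he⟩ := nonempty_iff_ne_empty.2 hE
    have hunit : ∀ e' ∈ (B.N.erase e_q).erase e_p, (∃ ν₁ ν₂ : (Fin n → ZMod 2) → ZMod 2, IsAffineFn ν₁ ∧ IsAffineFn ν₂ ∧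
      (∃ κ : ZMod 2, ∀ x, qform (B.D e') (fun j => I.vars j 2) (fun j => I.vars j 3) x = qDir I B (1, 0) x + ν₁ x * ν₂ x + κ) ∧
      ∃ j₁ j₂ : Fin m, ∃ σ τ : Fin n, j₁ ≠ j₂ ∧ B.D e' = {j₁, j₂} ∧ Disjoint (andPair I j₁) (andPair I j₂) ∧ σ ∈ andPair I j₁ ∧ τ ∈ andPair I j₂ ∧
      (∀ v : Fin n, (ν₁ (Pi.single v 1) ≠ ν₁ 0 ∨ ν₂ (Pi.single v 1) ≠ ν₂ 0) ↔ (v = σ ∨ v = τ)) ∧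
      ∀ v w : Fin n, polarDir I B (1, 0) (Pi.single v 1) (Pi.single w 1) =
        (if AndAdj I (B.D e') v w then 1 else 0) + (if (v = σ ∧ w = τ) ∨ (v = τ ∧ w = σ) then 1 else 0)) := fun e' he' => by
      rcases hsort e' he' with h | h | h
      · exact absurd h h5
      · exact h
      · exact absurd h hnor
    refine ⟨e, eq_singleton_iff_unique_mem.2 ⟨he, fun e' he' => ?_⟩, hunit e he⟩
    obtain ⟨_, _, -, -, -, j₁, j₂, σ, τ, hj, hDe, hdisj, hσ, hτ, -, hpol⟩ := hunit e he
    obtain ⟨_, _, -, -, -, k₁, k₂, σ', τ', hk, hDe', hdisj', hσ', hτ', -, hpol'⟩ := hunit e' he'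
    exact (caseP_unit_unique I hI hS hD.wf (mem_of_mem_erase (mem_of_mem_erase he)) (mem_of_mem_erase (mem_of_mem_erase he'))
      ⟨j₁, j₂, σ, τ, hj, hDe, hdisj, hσ, hτ, hpol⟩ ⟨k₁, k₂, σ', τ', hk, hDe', hdisj', hσ', hτ', hpol'⟩).symm

end

end Summit.PneNP.PneNP.Theorems.PstarCrossCasePStructure
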